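import Literature.IUT.LogVolume.TensorPacketScaling
import Literature.IUT.LogVolume.TensorPacketLemmas
import HarnessLib

/-!
# Tensor packets: the log-volume of a CAPSULE region `(⊗_i x_i)·A` is `μ^log(A) + Σ_i log ‖x_i‖` —
# additivity over the labels of [IUTchIII] Prop. 3.9 (i)/(iii) at the REAL tensor packet (proof-only)

S. Mochizuki, *Inter-universal Teichmüller theory III*, kurims manuscript (May 2020), Prop. 3.9 (i) p. 115 (the
packet-normalised log-volumes `μ^log_{A,v_ℚ}` on `𝓘^ℚ(^A𝓕_{v_ℚ}) = ⊗_{α∈A} 𝓘^ℚ(^α𝓕_{v_ℚ})`) and (iii) p. 117 (their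
sums over `v_ℚ`, "equal to the degree of the arithmetic line bundle … relative to a suitable normalization");
Remark 3.1.1 (ii)–(iv); [IUTchIV] Prop. 1.4 (i) p. 13 (`μ^log` on `⊗_{ℚ_p} k_i`); Dupuy–Hilado §3.7 (3.7)
"`log μ̄(a_{v_{r−1}}·U) = ln|a_{v_{r−1}}|_p + log μ̄(U)`, the action … through the `r`th tensor factor".
[claim: Mochizuki2012, status: disputed] for the [IUTchIII] sentences.

The layer-L6 divisor-level models of Prop. 3.9 (iii) for a capsule `A` (abc-iut-L6-d3
`PacketLogVolumesCapsules(Normalized).lean`; abc-iut-w4-d035's finding d035-F1 with its kernel witness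
`PacketWeightsCapsuleAdditivity.lean`) DECLARE the packet-normalised log-volume of a capsule region `⊗_α 𝔞_α`
to be ADDITIVE over the labels, `Σ_α μ^log_α(𝔞_α)`, in one unit for every `A`. THIS proof-only file makes that a
THEOREM of the REAL one-place tensor packet `V = ⊗_{ℚ_p} k_i` of campaign S (`TensorPacketRing`,
`TensorPacketHaar.tensorLogVolume` = Mochizuki's `μ^log`, normalised by `dim_{ℚ_p} V` and `μ^log((R_I)^∼) = 0`):

* `prod_iota_eq_purePacket` — `∏_i ι_i(x_i) = ⊗_i x_i` (a pure tensor is the product of its one-slot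
  twists);
* `haar_image_mulLeft_pos` / `_lt_top` — multiplication by a unit of `V` keeps a region of positive finite
  volume of positive finite volume (Haar modulus);
* **`tensorLogVolume_prod_iota_mul`** / **`tensorLogVolume_purePacket_mul`** — for `x_i ∈ k_i^×` and a region
  `A ⊆ V` of positive finite volume, `μ^log((⊗_i x_i)·A) = μ^log(A) + Σ_i log ‖x_i‖`: abc-iut's
  `tensorLogVolume_iota_smul` (`TensorPacketScaling.lean`, Dupuy–Hilado (3.7)) applied slot by slot;
* **`tensorLogVolume_purePacket_mul_normalizedPacket`** — the CAPSULE REGION `(⊗_i x_i)·(R_I)^∼` (the tensor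
  product of the fractional ideals `x_i·𝒪`) has `μ^log = Σ_i log ‖x_i‖` whenever `(R_I)^∼` is compact (its
  normalisation `μ^log((R_I)^∼) = 0`): the label-ADDITIVITY of the printed packet-normalisation, weight `1` for
  every number of labels — d035-F1's reading, now at the real packet.

Classical Haar-measure bookkeeping in campaign-S vocabulary (seat abc-iut-w5-d178, residual R-iii-tensor of
plan/L6/SUBDAG-IUTchIII-Prop-39.md). No new definitions; nothing here bears on the disputed [IUTchIII]
Cor. 3.12 or takes a side; typed ≠ endorsed. [cite: DupuyHilado2025, §3.7]
[cite: Mochizuki2012, IUTchIV Prop. 1.4 (i) p. 13]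
-/

noncomputable section

open MeasureTheory Set Module
open scoped NNReal ENNReal Pointwise TensorProduct NormedField

namespace Literature.IUT.LogVolume

variable (p : ℕ) [Fact p.Prime]
variable {I : Type} [Fintype I] [DecidableEq I]
variable (k : I → Type) [∀ i, NontriviallyNormedField (k i)] [∀ i, NormedAlgebra ℚ_[p] (k i)]
  [∀ i, IsUltrametricDist (k i)] [∀ i, ProperSpace (k i)] [Nonempty I]

/-! ## A pure tensor is the product of its one-slot twists -/

omit [∀ i, IsUltrametricDist (k i)] [∀ i, ProperSpace (k i)] [Nonempty I] in
/-- **`∏_i ι_i(x_i) = ⊗_i x_i`**: the pure tensor `⊗ x_i` is the product, in the ring `V`, of the elements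
`ι_i(x_i) = 1 ⊗ ⋯ ⊗ x_i ⊗ ⋯ ⊗ 1` (`⊗` is multiplicative and `∏_i mulSingle_i(x_i) = x`).
[claim: Mochizuki2012, status: disputed] -/
theorem prod_iota_eq_purePacket (x : Π i, k i) : ∏ i, iota p k i (x i) = purePacket p k x := by
  have h : ∀ i, iota p k i (x i) = PiTensorProduct.tprodMonoidHom ℚ_[p] (Pi.mulSingle i (x i)) :=
    fun i => iota_eq_purePacket p k i (x i)
  simp_rw [h, ← map_prod, Finset.univ_prod_mulSingle]
  rfl

omit [∀ i, IsUltrametricDist (k i)] [∀ i, ProperSpace (k i)] [Nonempty I] in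
/-- The same over a sub-collection of slots `s ⊆ I`: `∏_{i∈s} ι_i(x_i) = ⊗ y` with `y_i = x_i` on `s`, `1` off `s`.
[claim: Mochizuki2012, status: disputed] -/
theorem prod_iota_eq_purePacket_piecewise (s : Finset I) (x : Π i, k i) :
    ∏ i ∈ s, iota p k i (x i) = purePacket p k (fun i => if i ∈ s then x i else 1) := by
  rw [← prod_iota_eq_purePacket]
  rw [← Finset.prod_filter_mul_prod_filter_not Finset.univ (· ∈ s)]
  have h1 : ∏ i ∈ Finset.univ.filter (· ∈ s), iota p k i (if i ∈ s then x i else 1) =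
      ∏ i ∈ s, iota p k i (x i) := by
    rw [Finset.filter_mem_eq_inter, Finset.univ_inter]
    exact Finset.prod_congr rfl fun i hi => by rw [if_pos hi]
  have h2 : ∏ i ∈ Finset.univ.filter (fun i => ¬ i ∈ s), iota p k i (if i ∈ s then x i else 1) = 1 :=
    Finset.prod_eq_one fun i hi => by
      rw [Finset.mem_filter] at hi
      rw [if_neg hi.2, map_one]
  rw [h1, h2, mul_one]

/-! ## Multiplication by a unit keeps positive finite volume -/

/-- Multiplication by a unit `u ∈ V^×` keeps a region of positive volume of positive volume (Haar modulus
`μ(u·R_I) > 0`). [cite: MochizukiAbsTopIII2015, Prop. 5.7 (i)(b) p. 138] -/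
theorem haar_image_mulLeft_pos (u : (PacketAlgebra p k)ˣ) {A : Set (PacketAlgebra p k)}
    (hA : 0 < (integerStructure p k).haar A) :
    0 < (integerStructure p k).haar ((fun x => (u : PacketAlgebra p k) * x) '' A) := by
  have himg : packetMulLeftEquiv p k u '' A = (fun x => (u : PacketAlgebra p k) * x) '' A := rfl
  rw [← himg, (integerStructure p k).haar_image (packetMulLeftEquiv p k u) A]
  exact ENNReal.mul_pos ((integerStructure p k).haar_image_self_pos _).ne' hA.ne'

/-- … and a region of finite volume of finite volume. [cite: MochizukiAbsTopIII2015, Prop. 5.7 (i)(b) p. 138] -/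
theorem haar_image_mulLeft_lt_top (u : (PacketAlgebra p k)ˣ) {A : Set (PacketAlgebra p k)}
    (hA' : (integerStructure p k).haar A < ∞) :
    (integerStructure p k).haar ((fun x => (u : PacketAlgebra p k) * x) '' A) < ∞ := by
  have himg : packetMulLeftEquiv p k u '' A = (fun x => (u : PacketAlgebra p k) * x) '' A := rfl
  rw [← himg, (integerStructure p k).haar_image (packetMulLeftEquiv p k u) A]
  exact ENNReal.mul_lt_top ((integerStructure p k).haar_image_self_lt_top _) hA'

/-! ## Slot-by-slot scaling: `μ^log((⊗ x_i)·A) = μ^log(A) + Σ_i log ‖x_i‖` -/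

/-- **Scaling through a set `s` of slots**: for units `x_i ∈ k_i^×` and `A` of positive finite volume,
`μ^log((∏_{i∈s} ι_i(x_i))·A) = μ^log(A) + Σ_{i∈s} log ‖x_i‖` (induction on `s`, one slot at a time by
`tensorLogVolume_iota_smul`). [cite: DupuyHilado2025, §3.7] -/
theorem tensorLogVolume_prod_iota_mul (x : Π i, (k i)ˣ) (s : Finset I) {A : Set (PacketAlgebra p k)}
    (hA : 0 < (integerStructure p k).haar A) (hA' : (integerStructure p k).haar A < ∞) :
    tensorLogVolume p k ((fun y => (∏ i ∈ s, iota p k i (x i)) * y) '' A) =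
      tensorLogVolume p k A + ∑ i ∈ s, Real.log ‖(x i : k i)‖ := by
  induction s using Finset.induction_on with
  | empty => simp
  | insert a s ha ih =>
    rw [Finset.prod_insert ha, Finset.sum_insert ha]
    -- `(ι_a(x_a) · ∏_s) · y = ι_a(x_a) · ((∏_s) · y)`: the image is an image of an image
    have hcomp : (fun y => (iota p k a (x a) * ∏ i ∈ s, iota p k i (x i)) * y) '' A =
        (fun y => iota p k a (x a) * y) '' ((fun y => (∏ i ∈ s, iota p k i (x i)) * y) '' A) := by
      rw [Set.image_image]
      exact Set.image_congr fun y _ => by rw [mul_assoc]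
    -- the intermediate region has positive finite volume (it is `u·A` for the unit `u = ∏_s ι_i(x_i)`)
    have hunit : (∏ i ∈ s, iota p k i (x i)) = ((∏ i ∈ s, iotaUnits p k i (x i) : (PacketAlgebra p k)ˣ) :
        PacketAlgebra p k) := by
      rw [Units.coe_prod]
      exact Finset.prod_congr rfl fun i _ => (coe_iotaUnits p k i (x i)).symm
    have hB : 0 < (integerStructure p k).haar ((fun y => (∏ i ∈ s, iota p k i (x i)) * y) '' A) := by
      rw [hunit]; exact haar_image_mulLeft_pos p k _ hA
    have hB' : (integerStructure p k).haar ((fun y => (∏ i ∈ s, iota p k i (x i)) * y) '' A) < ∞ := by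
      rw [hunit]; exact haar_image_mulLeft_lt_top p k _ hA'
    rw [hcomp, tensorLogVolume_iota_smul p k a (x a) hB hB', ih]
    ring

/-- **`μ^log((⊗_i x_i)·A) = μ^log(A) + Σ_i log ‖x_i‖`** for units `x_i ∈ k_i^×` and any region `A ⊆ V` of positive
finite volume — multiplication by the pure tensor `⊗ x_i = ∏_i ι_i(x_i)` scales `μ^log` ADDITIVELY over the slots.
[cite: DupuyHilado2025, §3.7] -/
theorem tensorLogVolume_purePacket_mul (x : Π i, (k i)ˣ) {A : Set (PacketAlgebra p k)}
    (hA : 0 < (integerStructure p k).haar A) (hA' : (integerStructure p k).haar A < ∞) :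
    tensorLogVolume p k ((fun y => purePacket p k (fun i => (x i : k i)) * y) '' A) =
      tensorLogVolume p k A + ∑ i, Real.log ‖(x i : k i)‖ := by
  rw [← prod_iota_eq_purePacket]
  exact tensorLogVolume_prod_iota_mul p k x Finset.univ hA hA'

/-- **The capsule region**: if `(R_I)^∼` is compact (its normalisation `μ^log((R_I)^∼) = 0` is then honest,
[IUTchIV] Prop. 1.1), the region `(⊗_i x_i)·(R_I)^∼` — the tensor product of the "fractional ideals" `x_i·𝒪` of the
slots — has `μ^log((⊗_i x_i)·(R_I)^∼) = Σ_i log ‖x_i‖`: the packet-normalised log-volume of a capsule region is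
the SUM over the labels of the slot log-volumes, with weight `1` whatever the number of labels (the reading of
abc-iut-w4-d035's d035-F1 / abc-iut-L6-d3's `capsuleLogVolume₁`, at the REAL tensor packet).
[claim: Mochizuki2012, status: disputed] -/
theorem tensorLogVolume_purePacket_mul_normalizedPacket (x : Π i, (k i)ˣ)
    (hc : IsCompact (normalizedPacket p k : Set (PacketAlgebra p k))) :
    tensorLogVolume p k
        ((fun y => purePacket p k (fun i => (x i : k i)) * y) '' (normalizedPacket p k : Set (PacketAlgebra p k))) =
      ∑ i, Real.log ‖(x i : k i)‖ := by
  have h0 : 0 < (integerStructure p k).haar (normalizedPacket p k : Set (PacketAlgebra p k)) :=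
    (integerStructure p k).haar_pos_of_isOpen (isOpen_normalizedPacket p k)
      ⟨1, (normalizedPacket p k).one_mem⟩
  have h1 : (integerStructure p k).haar (normalizedPacket p k : Set (PacketAlgebra p k)) < ∞ :=
    (integerStructure p k).haar_lt_top_of_isCompact hc
  rw [tensorLogVolume_purePacket_mul p k x h0 h1, tensorLogVolume_normalizedPacket, zero_add]

/-- The same in the `•` notation for subsets of `V` (`(⊗ x_i) • (R_I)^∼`). [claim: Mochizuki2012, status: disputed] -/
theorem tensorLogVolume_purePacket_smul_normalizedPacket (x : Π i, (k i)ˣ)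
    (hc : IsCompact (normalizedPacket p k : Set (PacketAlgebra p k))) :
    tensorLogVolume p k
        (purePacket p k (fun i => (x i : k i)) • (normalizedPacket p k : Set (PacketAlgebra p k))) =
      ∑ i, Real.log ‖(x i : k i)‖ := by
  rw [← Set.image_smul]
  exact tensorLogVolume_purePacket_mul_normalizedPacket p k x hc

/-- **Label-additivity with prescribed slot sizes**: if `‖x_i‖ = p^{−λ_i}` ("`x_i = p^{λ_i}`", `ord = λ_i`), then
`μ^log((⊗_i x_i)·(R_I)^∼) = −(Σ_i λ_i)·log p` — the capsule analogue of [IUTchIV] Prop. 1.4's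
`μ^log(p^λ·(R_I)^∼) = −λ·log p`. [cite: Mochizuki2012, IUTchIV Prop. 1.4 (i) p. 13] -/
theorem tensorLogVolume_purePacket_mul_normalizedPacket_of_norm_eq_rpow (x : Π i, (k i)ˣ) (lam : I → ℝ)
    (hx : ∀ i, ‖(x i : k i)‖ = (p : ℝ) ^ (-lam i))
    (hc : IsCompact (normalizedPacket p k : Set (PacketAlgebra p k))) :
    tensorLogVolume p k
        ((fun y => purePacket p k (fun i => (x i : k i)) * y) '' (normalizedPacket p k : Set (PacketAlgebra p k))) =
      -(∑ i, lam i) * Real.log p := by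
  have hp : (0 : ℝ) < p := by exact_mod_cast (Fact.out : p.Prime).pos
  rw [tensorLogVolume_purePacket_mul_normalizedPacket p k x hc]
  simp_rw [hx, Real.log_rpow hp]
  rw [← Finset.sum_mul, Finset.sum_neg_distrib]

end Literature.IUT.LogVolume

end
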